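import Mathlib.RingTheory.Filtration
import Mathlib.RingTheory.LocalRing.RingHom.Basic
import Literature.RingTheory.TightClosure.TightClosure
import HarnessLib

/-!
# Tight closedness from the powers (crux `FrobeniusLadder.FRationalResolution`, line `Sketch`)

Stub `stub_tc_of_powers` (worker C2) of the skeleton `Sketch` for crux
stmt-ResolutionOfSingularities-15317, theme C ([HochsterHuneke1994, Prop. 6.27 (a)] for quotients of
regular local rings without a Cohen–Macaulay hypothesis: ONE tightly closed parameter ideal makes all
of them tightly closed), KRULL STEP.  Let `(R, 𝔪)` be a Noetherian local ring of prime characteristic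
`p`, `J ⊆ R` an ideal and `a ∈ 𝔪`.  If the ideals `(J, a^M) = J ⊔ (a^M)` are tightly closed for all
`M ≥ 1`, then `J` is tightly closed.

Proof.  For `y ∈ J^*` and `M ≥ 1`, `y ∈ (J, a^M)^* = (J, a^M) ⊆ J + 𝔪^M` (monotonicity of tight
closure and `a^M ∈ 𝔪^M`).  Hence `y ∈ ⋂_M (J + 𝔪^M) = J` by Krull's intersection theorem in the
Noetherian local ring `R/J` (if `J = R` there is nothing to prove) — the same manipulation as in the
sibling `…PartialSopTightlyClosed` (partial parameter ideals of an F-rational local ring).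
-/

-- single-problem summit: the doubled namespace component is forced
set_option linter.dupNamespace false

namespace Summit.ResolutionOfSingularities.ResolutionOfSingularities.Theorems.FRationalResolution

open IsLocalRing Literature.RingTheory.TightClosure

/-- STUB (worker, C2) — **TIGHT CLOSEDNESS FROM THE POWERS (KRULL STEP).**  In a Noetherian local ring
`(R, 𝔪)` of prime characteristic `p`, let `J` be an ideal and `a ∈ 𝔪`.  If `(J, a^M)` is tightly
closed for every `M ≥ 1`, then `J` is tightly closed:
`J^* ⊆ ⋂_M (J, a^M)^* = ⋂_M (J, a^M) ⊆ ⋂_M (J + 𝔪^M) = J` by Krull's intersection theorem in `R/J`.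
[folklore; cf. HochsterHuneke1994 proof of Thm. 4.2 (c)] -/
theorem stub_tc_of_powers (p : ℕ) [Fact p.Prime] (R : Type) [CommRing R] [CharP R p] [IsNoetherianRing R]
    [IsLocalRing R] (J : Ideal R) (a : R) (ha : a ∈ IsLocalRing.maximalIdeal R)
    (h : ∀ M : ℕ, 0 < M → Literature.RingTheory.TightClosure.IsTightlyClosed p (J ⊔ Ideal.span {a ^ M})) :
    Literature.RingTheory.TightClosure.IsTightlyClosed p J := by
  rw [isTightlyClosed_iff_le]
  intro y hy
  -- `y ∈ J + 𝔪ⁿ` for every `n ≥ 1`, via the tightly closed ideal `(J, aⁿ)`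
  have hyn : ∀ n : ℕ, 0 < n → y ∈ J ⊔ maximalIdeal R ^ n := by
    intro n hn
    have hyJ : y ∈ J ⊔ Ideal.span {a ^ n} := (h n hn).le (tightClosure_mono p le_sup_left hy)
    refine (sup_le le_sup_left ?_ : J ⊔ Ideal.span {a ^ n} ≤ J ⊔ maximalIdeal R ^ n) hyJ
    rw [Ideal.span_singleton_le_iff_mem]
    exact Ideal.mem_sup_right (Ideal.pow_mem_pow ha n)
  -- the degenerate case `J = R`
  rcases eq_or_ne J ⊤ with rfl | hJtop
  · exact Submodule.mem_top
  -- Krull's intersection theorem in `R/J`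
  haveI : Nontrivial (R ⧸ J) := Ideal.Quotient.nontrivial_iff.mpr hJtop
  haveI : IsLocalRing (R ⧸ J) :=
    IsLocalRing.of_surjective' (Ideal.Quotient.mk J) Ideal.Quotient.mk_surjective
  have hmk : (maximalIdeal R).map (Ideal.Quotient.mk J) = maximalIdeal (R ⧸ J) :=
    IsLocalRing.map_maximalIdeal_of_surjective _ Ideal.Quotient.mk_surjective
  have hbar : Ideal.Quotient.mk J y ∈ ⨅ n : ℕ, maximalIdeal (R ⧸ J) ^ n := by
    refine Ideal.mem_iInf.mpr fun n => ?_
    rcases Nat.eq_zero_or_pos n with rfl | hn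
    · rw [pow_zero, Ideal.one_eq_top]
      trivial
    have := Ideal.mem_map_of_mem (Ideal.Quotient.mk J) (hyn n hn)
    rw [Ideal.map_sup, Ideal.map_quotient_self, bot_sup_eq, Ideal.map_pow, hmk] at this
    exact this
  rw [Ideal.iInf_pow_eq_bot_of_isLocalRing _ (maximalIdeal.isMaximal (R ⧸ J)).ne_top,
    Ideal.mem_bot, Ideal.Quotient.eq_zero_iff_mem] at hbar
  exact hbar

end Summit.ResolutionOfSingularities.ResolutionOfSingularities.Theorems.FRationalResolution
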